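import Literature.NumberTheory.QuadraticFields.SquareRootGenerator
import Mathlib.RingTheory.RootsOfUnity.PrimitiveRoots
import Mathlib.FieldTheory.Galois.Basic
import HarnessLib

/-!
# Scholz–Hecke unit criterion, direction (ii): descent of the Kummer generator to the mirror field

Topic `NumberTheory/QuadraticFields`.  Theorem-only file (no definition, no named fact), part of
the proof of `ScholzHecke_unitCubeCriterion` (`ScholzHeckeUnitCriterion.lean`), direction
`3 ∣ h(−d) → UnitCubeAtThree d` (Washington, *Introduction to Cyclotomic Fields*, proof of
Thm. 10.10, the step "we may assume `β ∈ k = ℚ(√3d)`").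

Everything here is abstract field theory.  Let `K ⊆ M ⊆ L` be fields of characteristic `0` with
`K = ℚ(δ)` quadratic, `M = K(λ)`, `λ² = −3` (so `ζ = (λ−1)/2 ∈ M` is a primitive cube root of
unity, `isPrimitiveRoot_of_sq_eq_neg_three`), and let `L/M` be cyclic cubic with Kummer generator
`y`: `y³ = θ ∈ M`, `y ∉ M`, and `σ ∈ Aut(L/M)` with fixed field `M` and `σ y = ζ y`.

* `exists_eq_pow_mul_algebraMap_of_pow_three_mem` — **uniqueness of Kummer generators**: any
  `y' ∈ L` with `y'³ ∈ M` is `yⁱ·m`, `m ∈ M`.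
* `exists_fixed_kummer_datum` — **the descent**: let `ĝ : L → L`, `ρ : M → M` be ring
  homomorphisms with `ĝ|_M = ρ`, `ρ λ = −λ`, `ρ|_K` the conjugation of `K`, `ρ² = 1`, and
  `ĝ σ = σ⁻¹ ĝ` (the restriction to `L = E·K(ζ)` of an automorphism of `K̄/ℚ` which is
  `δ ↦ −δ`, `ζ ↦ ζ²` and normalises the cubic class field `E`, acting on `Gal(E/K)` by inversion).
  Then `ρ θ ≡ θ (mod M׳)` (uniqueness plus the inversion, which forces the eigenvalue of `ĝ y`
  under `σ` to be `ζ`), so `x = θ·ρ(θ) ≡ θ²` is **not a cube in `M`**, has the cube root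
  `y·ĝ(y) ∈ L`, is fixed by `ρ`, and therefore has coordinates `x = p + r·δλ`, `p, r ∈ ℚ`:
  it lies in the mirror field `ℚ(δλ) = ℚ(√3d)`.
* `apply_algebraMap_eq_conj` — an automorphism with `δ ↦ −δ` acts on `K = ℚ(δ)` as the
  conjugation `Quadratic.conj`.

## References

* L. C. Washington, *Introduction to Cyclotomic Fields*, GTM 83 (2nd ed. 1997), Thm. 10.10 and
  its proof. [Washington1997]
-/

noncomputable section

open Module

namespace Literature.NumberTheory.QuadraticFields

namespace ScholzHecke

/-- The non-trivial automorphism of `K = ℚ(δ)` is `u + vδ ↦ u − vδ`: an automorphism `g` of an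
extension `Ω ⊇ K` with `g δ = −δ` acts on `K` as `Quadratic.conj`. [folklore] -/
theorem apply_algebraMap_eq_conj {K : Type*} [Field K] [CharZero K] (h2 : finrank ℚ K = 2) {δ : K}
    (hδ : δ ∉ Set.range (algebraMap ℚ K)) {c : ℚ} (hc : δ ^ 2 = algebraMap ℚ K c)
    {Ω : Type*} [Field Ω] [Algebra K Ω] [Algebra ℚ Ω] [IsScalarTower ℚ K Ω] (g : Ω ≃ₐ[ℚ] Ω)
    (hg : g (algebraMap K Ω δ) = -algebraMap K Ω δ) (x : K) :
    g (algebraMap K Ω x) = algebraMap K Ω (Quadratic.conj h2 hδ hc x) := by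
  obtain ⟨u, v, rfl⟩ := Quadratic.exists_eq_add_mul h2 hδ x
  have hu : g (algebraMap K Ω (algebraMap ℚ K u)) = algebraMap K Ω (algebraMap ℚ K u) := by
    rw [← IsScalarTower.algebraMap_apply, AlgEquiv.commutes]
  have hv : g (algebraMap K Ω (algebraMap ℚ K v)) = algebraMap K Ω (algebraMap ℚ K v) := by
    rw [← IsScalarTower.algebraMap_apply, AlgEquiv.commutes]
  rw [Quadratic.conj_add_mul, map_add, map_mul, map_add, map_mul, hu, hv, hg, map_sub, map_mul]
  ring

/-- **Kummer generators of a cyclic cubic extension are unique up to `y ↦ yⁱ · m`.**  Let `σ` be an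
`F`-automorphism of `N` whose fixed elements are exactly `F`, `ζ ∈ F` a primitive cube root of
unity and `y ∈ N` non-zero with `σ y = ζ y`.  If `y' ∈ N` has `y'³ ∈ F`, then `y' = yⁱ · m` with
`i < 3`, `m ∈ F` (`σ y'/y'` is a cube root of unity `ζⁱ`, and `y'/yⁱ` is fixed by `σ`).
[folklore] -/
theorem exists_eq_pow_mul_algebraMap_of_pow_three_mem {F N : Type*} [Field F] [Field N]
    [Algebra F N] (σ : N ≃ₐ[F] N) (hfix : ∀ z : N, σ z = z → z ∈ Set.range (algebraMap F N))
    {ζ : F} (hζ : IsPrimitiveRoot ζ 3) {y : N} (hy0 : y ≠ 0)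
    (hσy : σ y = algebraMap F N ζ * y) {y' : N} (hy' : y' ^ 3 ∈ Set.range (algebraMap F N)) :
    ∃ (i : ℕ) (m : F), i < 3 ∧ y' = y ^ i * algebraMap F N m := by
  by_cases hy'0 : y' = 0
  · exact ⟨0, 0, by norm_num, by simp [hy'0]⟩
  obtain ⟨t, ht⟩ := hy'
  have hζN : IsPrimitiveRoot (algebraMap F N ζ) 3 := hζ.map_of_injective (algebraMap F N).injective
  have h3 : (σ y' / y') ^ 3 = 1 := by
    rw [div_pow, ← map_pow, ← ht, AlgEquiv.commutes, div_self]
    rw [ht]; exact pow_ne_zero 3 hy'0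
  obtain ⟨i, hi, hω⟩ := hζN.eq_pow_of_pow_eq_one h3
  rw [eq_comm, div_eq_iff hy'0] at hω
  have hfixed : σ (y' / y ^ i) = y' / y ^ i := by
    have hζ0 : algebraMap F N (ζ ^ i) ≠ 0 := by
      rw [map_ne_zero]; exact pow_ne_zero i (hζ.ne_zero (by norm_num))
    rw [map_div₀, map_pow, hσy, hω, mul_pow, ← map_pow]
    field_simp
  obtain ⟨m, hm⟩ := hfix _ hfixed
  refine ⟨i, m, hi, ?_⟩
  rw [hm, mul_div_cancel₀ _ (pow_ne_zero i hy0)]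

/-- `ζ = (λ − 1)/2` is a primitive cube root of unity when `λ² = −3` (characteristic `0`).
[folklore] -/
theorem isPrimitiveRoot_of_sq_eq_neg_three {M : Type*} [Field M] [CharZero M] {lam : M}
    (hlam : lam ^ 2 = -3) : IsPrimitiveRoot ((lam - 1) / 2) 3 := by
  refine IsPrimitiveRoot.mk_of_lt _ (by norm_num) ?_ fun l hl1 hl3 => ?_
  · linear_combination ((lam - 3) / 8) * hlam
  · interval_cases l
    · rw [pow_one]
      intro h
      have : lam = 3 := by linear_combination 2 * h
      rw [this] at hlam; norm_num at hlam
    · intro h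
      have h' : lam ^ 2 - 2 * lam + 1 = 4 := by linear_combination 4 * h
      rw [hlam] at h'
      have : lam = -3 := by linear_combination -h' / 2
      rw [this] at hlam; norm_num at hlam

/-- **Descent of the Kummer generator (Washington, proof of Thm. 10.10), abstract form.**  Let
`K ⊆ M ⊆ L` be fields of characteristic `0`, `[M : K] = 2`, `M = K(λ)` with `λ² = −3`, and let
`σ ∈ Aut(L/M)` have fixed field `M`, `y ∈ L ∖ M`, `y ≠ 0`, `y³ = θ ∈ M`, `σ y = ζ y`
(`ζ = (λ−1)/2`).  Let `ĝ : L → L`, `ρ : M → M` be ring homomorphisms with `ĝ ∘ ι = ι ∘ ρ`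
(`ι : M → L`), `ρ λ = −λ`, `ρ|_K` the conjugation of `K = ℚ(δ)`, `ρ² = 1`, and `ĝ σ = σ⁻¹ ĝ`.
Then `x = θ·ρ(θ) ∈ M` has a cube root in `L`, is not a cube in `M`, and
`x = p + r·δλ` with `p, r ∈ ℚ` (so `x` lies in the mirror field `ℚ(δλ)`).
[cite: Washington1997, Thm 10.10 (proof)] -/
theorem exists_fixed_kummer_datum {K M L : Type*} [Field K] [CharZero K] [Field M] [Field L]
    [Algebra ℚ K] [Algebra K M] [Algebra M L] [Algebra ℚ M] [IsScalarTower ℚ K M] [CharZero M]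
    (h2 : finrank ℚ K = 2) {δ : K} (hδ : δ ∉ Set.range (algebraMap ℚ K)) {c : ℚ}
    (hc : δ ^ 2 = algebraMap ℚ K c) (hKM : finrank K M = 2) {lam : M} (hlam : lam ^ 2 = -3)
    (hlamK : lam ∉ Set.range (algebraMap K M))
    (σ : L ≃ₐ[M] L) (hfix : ∀ z : L, σ z = z → z ∈ Set.range (algebraMap M L))
    {y : L} (hy0 : y ≠ 0) {θ : M} (hyθ : y ^ 3 = algebraMap M L θ)
    (hyM : y ∉ Set.range (algebraMap M L)) (hσy : σ y = algebraMap M L ((lam - 1) / 2) * y)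
    (ĝ : L →+* L) (ρ : M →+* M) (hĝρ : ∀ m : M, ĝ (algebraMap M L m) = algebraMap M L (ρ m))
    (hρlam : ρ lam = -lam)
    (hρK : ∀ k : K, ρ (algebraMap K M k) = algebraMap K M (Quadratic.conj h2 hδ hc k))
    (hρρ : ∀ m : M, ρ (ρ m) = m) (hinv : ∀ z : L, ĝ (σ z) = σ.symm (ĝ z)) :
    ∃ (w : L) (p r : ℚ), w ^ 3 = algebraMap M L (θ * ρ θ) ∧ (∀ e : M, e ^ 3 ≠ θ * ρ θ) ∧
      θ * ρ θ = algebraMap ℚ M p + algebraMap ℚ M r * (algebraMap K M δ * lam) := by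
  have hζ : IsPrimitiveRoot ((lam - 1) / 2) 3 := isPrimitiveRoot_of_sq_eq_neg_three hlam
  set ζ : M := (lam - 1) / 2 with hζdef
  have hζ3 : ζ ^ 3 = 1 := hζ.pow_eq_one
  have hθ0 : θ ≠ 0 := fun h => by
    rw [h, map_zero] at hyθ
    exact hy0 (pow_eq_zero_iff (n := 3) (by norm_num) |>.mp hyθ)
  -- `y₂ = ĝ y`, a cube root of `ρ θ`
  set y₂ : L := ĝ y with hy₂
  have hy₂3 : y₂ ^ 3 = algebraMap M L (ρ θ) := by rw [hy₂, ← map_pow, hyθ, hĝρ]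
  have hy₂0 : y₂ ≠ 0 := by rw [hy₂, map_ne_zero]; exact hy0
  obtain ⟨i, m, hi, hy₂eq⟩ :=
    exists_eq_pow_mul_algebraMap_of_pow_three_mem σ hfix hζ hy0 hσy ⟨ρ θ, hy₂3.symm⟩
  -- `ĝ ζ = ζ²`
  have hĝζ : ĝ (algebraMap M L ζ) = algebraMap M L (ζ ^ 2) := by
    rw [hĝρ, hζdef, map_div₀, map_sub, hρlam, map_one, map_ofNat]
    congr 1
    linear_combination (-1 / 4 : M) * hlam
  -- inversion forces `σ y₂ = ζ y₂`
  have hσy₂ : σ y₂ = algebraMap M L ζ * y₂ := by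
    have h := hinv y
    rw [hσy, map_mul, hĝζ, ← hy₂] at h
    -- `h : ζ² y₂ = σ⁻¹ y₂`, apply `σ`
    have h' := congrArg σ h
    rw [AlgEquiv.apply_symm_apply, map_mul, AlgEquiv.commutes] at h'
    -- `h' : ζ² σ y₂ = y₂`
    have hζL3 : (algebraMap M L ζ) ^ 3 = 1 := by rw [← map_pow, hζ3, map_one]
    rw [map_pow] at h'
    linear_combination (algebraMap M L ζ) * h' - (σ y₂) * hζL3
  -- but `σ y₂ = ζ^i y₂`, so `i = 1`
  have hσy₂' : σ y₂ = algebraMap M L ζ ^ i * y₂ := by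
    rw [hy₂eq, map_mul, map_pow, hσy, AlgEquiv.commutes, mul_pow, mul_assoc]
  have hi1 : i = 1 := by
    have hζL : IsPrimitiveRoot (algebraMap M L ζ) 3 :=
      hζ.map_of_injective (algebraMap M L).injective
    have heq : algebraMap M L ζ ^ i = algebraMap M L ζ ^ 1 := by
      rw [pow_one]
      exact mul_right_cancel₀ hy₂0 (hσy₂'.symm.trans hσy₂)
    exact hζL.pow_inj hi (by norm_num) heq
  rw [hi1, pow_one] at hy₂eq
  -- `ρ θ = θ m³`
  have hm0 : m ≠ 0 := by
    rintro rfl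
    rw [map_zero, mul_zero] at hy₂eq
    exact hy₂0 hy₂eq
  have hρθ : ρ θ = θ * m ^ 3 := by
    apply (algebraMap M L).injective
    rw [← hy₂3, hy₂eq, mul_pow, hyθ, map_mul, map_pow]
  -- `x = θ ρθ` is fixed by `ρ`; its coordinates
  have hρx : ρ (θ * ρ θ) = θ * ρ θ := by rw [map_mul, hρρ, mul_comm]
  obtain ⟨P, Q, hPQ⟩ := Quadratic.exists_eq_add_mul hKM hlamK (θ * ρ θ)
  have hρx' : ρ (θ * ρ θ) = algebraMap K M (Quadratic.conj h2 hδ hc P) +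
      algebraMap K M (-(Quadratic.conj h2 hδ hc Q)) * lam := by
    rw [hPQ, map_add, map_mul, hρK, hρK, hρlam, map_neg]; ring
  rw [hρx, hPQ] at hρx'
  obtain ⟨hP, hQ⟩ := Quadratic.ext_add_mul hlamK hρx'
  obtain ⟨p, hp⟩ := Quadratic.exists_eq_algebraMap_of_conj_eq h2 hδ hc hP.symm
  have hQ' : Quadratic.conj h2 hδ hc Q = -Q := by linear_combination hQ
  obtain ⟨r, hr⟩ := Quadratic.exists_eq_mul_of_conj_eq_neg h2 hδ hc hQ'
  refine ⟨y * y₂, p, r, ?_, ?_, ?_⟩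
  · rw [mul_pow, hyθ, hy₂3, ← map_mul]
  · -- not a cube in `M`: otherwise `θ` is a cube and `y ∈ M`
    intro e he
    rw [hρθ] at he
    have hu : (e / m) ^ 3 = θ ^ 2 := by
      rw [div_pow, he]; field_simp
    have hθcube : ((e / m) ^ 2 / θ) ^ 3 = θ := by
      rw [div_pow, ← pow_mul, show 2 * 3 = 3 * 2 by norm_num, pow_mul, hu]
      field_simp
    have hf0 : (e / m) ^ 2 / θ ≠ 0 := by
      intro h
      rw [h] at hθcube
      exact hθ0 (by rw [← hθcube]; norm_num)
    have hω : (y / algebraMap M L ((e / m) ^ 2 / θ)) ^ 3 = 1 := by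
      rw [div_pow, ← map_pow, hθcube, ← hyθ, div_self (pow_ne_zero 3 hy0)]
    obtain ⟨j, -, hj⟩ := (hζ.map_of_injective (algebraMap M L).injective).eq_pow_of_pow_eq_one hω
    apply hyM
    refine ⟨ζ ^ j * ((e / m) ^ 2 / θ), ?_⟩
    rw [map_mul, map_pow, hj, div_mul_cancel₀ _ ((_root_.map_ne_zero _).mpr hf0)]
  · rw [hPQ, hp, hr, map_mul, ← IsScalarTower.algebraMap_apply, ← IsScalarTower.algebraMap_apply,
      mul_assoc]

end ScholzHecke

end Literature.NumberTheory.QuadraticFields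

end
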